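import Summits.BirchSwinnertonDyer.Rank1Residual.Additive.RamifiedSevenGenusEllipticUnitColumn
import Summits.BirchSwinnertonDyer.Rank1Residual.Additive.RamifiedSevenGenusPartnerTransportRes
import HarnessLib

/-!
# (J-a)(1) The partner isogeny pair OVER `ℚ` (the record's forgotten `ℚ`-rationality, restored)

Pen D1135 (J-a)(1) / D1137, critic NOTE #18, route `K7r`, crux `stmt-BirchSwinnertonDyer-19945`.
`EllipticUnitColumn.exists_partner_isogenyPair` BUILDS its `Kcm`-pair as `(ψ₀.extendScalars Kcm, φ₀.extendScalars Kcm)` from a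
`ℚ`-isogeny `φ₀ : W → W₂` of degree `e ∈ {1, 2}` and its dual `ψ₀`, and then forgets `φ₀` in the `∃`.  This file keeps it:
`exists_partner_isogenyPairRat` (Kcm-free: `W₂`, `φ₀`, `ψ₀`, `e`, `j(W₂) = −3375`, `ψ₀ ∘ φ₀ = [e]`, `φ₀ ∘ ψ₀ = [e]`, `e ∈ {1,2}`),
the `7`-adic unit `u = e`, and the bridge to the `Kcm`-pair
(`PartnerTransport.extendScalars_extendScalars_eq_zsmul`, p823364) packaged as `exists_partner_isogenyPairRat_extendScalars` —
exactly the inputs of `PartnerTransport.transport` / `transportQ` / `resOver_transportQ_transport'` (prime-to-`7` unit `e`).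
The record extension `KummerColumnDataRat` ((J-a)(2)) is the successor's row.

References: Silverman, *AEC*, Thm. III.6.1 (a), Thm. III.6.2 (a) (dual isogeny, `ψ̂ ∘ ψ = [deg]`), III §4 (p. 66);
Gouvêa-style `p`-adic units: Serre, *Local Fields*, II §3.
-/

set_option autoImplicit false

noncomputable section

open scoped NumberField Classical
open WeierstrassCurve
open Literature.NumberTheory.GaloisRepresentations
open Literature.NumberTheory.EllipticCurves
open Literature.NumberTheory.EllipticCurves.Rank1Residual

namespace Summit.BirchSwinnertonDyer.Rank1Residual.Additive.GenusSeven

namespace PartnerTransport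

/-- ★ (J-a)(1) **The partner isogeny pair over `ℚ`.** For a globally minimal `W/ℚ` with `cmFieldDiscrOfJ W.j = −7` there are a
globally minimal partner `W₂` with `j(W₂) = −3375`, `ℚ`-ISOGENIES `φ₀ : W → W₂`, `ψ₀ : W₂ → W` and `e ∈ {1, 2}` with
`ψ₀ ∘ φ₀ = [e]` and `φ₀ ∘ ψ₀ = [e]` (`e = deg φ₀`; the proof of `EllipticUnitColumn.exists_partner_isogenyPair` minus the forgetting).
[cite: SilvermanAEC2009, Thm. III.6.1 (a) and Thm. III.6.2 (a)] -/
theorem exists_partner_isogenyPairRat {W : WeierstrassCurve ℚ} [W.IsElliptic] [W.IsGloballyMinimal]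
    (hj : cmFieldDiscrOfJ W.j = -7) :
    ∃ (W₂ : WeierstrassCurve ℚ) (_ : W₂.IsElliptic) (_ : W₂.IsGloballyMinimal) (φ₀ : Isogeny W W₂) (ψ₀ : Isogeny W₂ W) (e : ℤ),
      W₂.j = -3375 ∧ (∀ P, ψ₀ (φ₀ P) = e • P) ∧ (∀ Q, φ₀ (ψ₀ Q) = e • Q) ∧ (e = 1 ∨ e = 2) := by
  obtain ⟨W₂, hW₂, hmin, φ₀, hj₂, hdeg⟩ := EllipticUnitColumn.exists_partner hj
  haveI := hW₂
  obtain ⟨ψ₀, hψ₀⟩ := φ₀.exists_dual_comp_eq_deg_smul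
  have hφψ : ∀ Q, φ₀ (ψ₀ Q) = (φ₀.deg : ℤ) • Q := fun Q ↦ by
    obtain ⟨P, rfl⟩ := φ₀.surjective Q
    rw [hψ₀, map_zsmul]
  refine ⟨W₂, hW₂, hmin, φ₀, ψ₀, φ₀.deg, hj₂, hψ₀, hφψ, ?_⟩
  rcases hdeg with h | h
  · exact Or.inl (by exact_mod_cast h)
  · exact Or.inr (by exact_mod_cast h)

/-- (J-a)(1) **with the `7`-adic unit and the `Kcm`-bridge**: the same data together with a unit `u ∈ ℤ_7ˣ`, `u = e`
(`e ∈ {1,2}` is prime to `7`), and for `β := φ₀.extendScalars Kcm`, `α := ψ₀.extendScalars Kcm` the identities `α ∘ β = [e]` on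
`W(K̄)` and `β ∘ α = [e]` on `W₂(K̄)` (`extendScalars_extendScalars_eq_zsmul`) — the inputs of `PartnerTransport.transport`,
`transportQ`, `resOver_transportQ_transport'`. [cite: SilvermanAEC2009, Thm. III.6.1 (a), Thm. III.6.2 (a) and III.§4 (p. 66)] -/
theorem exists_partner_isogenyPairRat_extendScalars {W : WeierstrassCurve ℚ} [W.IsElliptic] [W.IsGloballyMinimal]
    (hj : cmFieldDiscrOfJ W.j = -7) (Kcm : Type) [Field Kcm] [NumberField Kcm] :
    ∃ (W₂ : WeierstrassCurve ℚ) (_ : W₂.IsElliptic) (_ : W₂.IsGloballyMinimal) (φ₀ : Isogeny W W₂) (ψ₀ : Isogeny W₂ W) (e : ℤ)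
      (u : ℤ_[7]ˣ),
      W₂.j = -3375 ∧ (∀ P, ψ₀ (φ₀ P) = e • P) ∧ (∀ Q, φ₀ (ψ₀ Q) = e • Q) ∧ (e = 1 ∨ e = 2) ∧ (u : ℤ_[7]) = e ∧
      (∀ P, ψ₀.extendScalars Kcm (φ₀.extendScalars Kcm P) = e • P) ∧
      (∀ Q, φ₀.extendScalars Kcm (ψ₀.extendScalars Kcm Q) = e • Q) := by
  obtain ⟨W₂, hW₂, hmin, φ₀, ψ₀, e, hj₂, hψφ, hφψ, he⟩ := exists_partner_isogenyPairRat hj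
  haveI := hW₂
  haveI : Fact (Nat.Prime 7) := ⟨by norm_num⟩
  have h7 : ¬ ((7 : ℕ) : ℤ) ∣ e := by
    rcases he with rfl | rfl <;> decide
  -- `e` prime to `7` is a `7`-adic unit (`‖e‖ = 1`; cf. `Rank2.isUnit_padicInt_intCast`, not importable here without the Rank2 cone)
  obtain ⟨u, hu⟩ : IsUnit (e : ℤ_[7]) := PadicInt.isUnit_iff.mpr (le_antisymm (PadicInt.norm_le_one _)
    (not_lt.mp fun hlt ↦ h7 ((PadicInt.norm_int_lt_one_iff_dvd e).mp hlt)))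
  exact ⟨W₂, hW₂, hmin, φ₀, ψ₀, e, u, hj₂, hψφ, hφψ, he, hu,
    extendScalars_extendScalars_eq_zsmul Kcm φ₀ ψ₀ hψφ, extendScalars_extendScalars_eq_zsmul Kcm ψ₀ φ₀ hφψ⟩

end PartnerTransport

end Summit.BirchSwinnertonDyer.Rank1Residual.Additive.GenusSeven

end
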